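import Literature.Topology.FourManifolds.MMSWRasmussenFacts
import Literature.Topology.FourManifolds.SmallSetComplement
import Summits.SmoothPoincare4.SmoothPoincare4.Theses.DottedCircleRasmussen
import Summits.SmoothPoincare4.SmoothPoincare4.Theorems.DottedCircleRasmussenDcrGapHelperFriendsCarrierExterior

/-!
# Assembly of stub `stub_friendsPi1` (line `mk_friends`, skeleton v2, crux `DcrGap`), part 1: the exterior
(item stmt-SmoothPoincare4-16128, route route-SmoothPoincare4-DottedCircleRasmussen)

Point-set facts about the model side of the friends-swap carrier used by the assembly
`stub_friendsPi1 ⇐ G1 ∧ G2 ∧ G3` (`…DcrGapStubFriendsPi1Reduction.lean`):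

* `FriendsPi1.tube_meridian_not_mem`, `FriendsPi1.continuous_tube_meridian` — the tube meridian
  `v ↦ T(0, v/2)` of a trivialised tube `T` of a neat model slice disc `Δ₁ = f₁(𝔻²)` is a continuous loop
  of the disc exterior `E = ℝ⁴ ∖ (D_k ∪ Δ₁)` (it misses `D_k` by the tube clause and `Δ₁` by injectivity
  of `T`, the boundary circle `f₁(𝕊¹) = K₁ ⊂ ∂D_k` lying in `D_k`);
* `FriendsPi1.exists_norm_gt_mem` — `E` contains points of arbitrarily large norm (`D_k ∪ Δ₁` is compact);
* `FriendsPi1.exists_exit` — from every point `d ∈ D_k` the ray `d + t e₃` runs inside `D_k` (the level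
  function `G_k` restricted to it is the parabola `G_k(d) + 2 t d₃ + t²`, the guard does not see `x₃`)
  until it crosses `∂D_k`, and a little further inside any open `U ⊇ D_k`: `d` is joined in `U` to a
  point of `U ∖ D_k`;
* `helper_friendsPi1_asm_exterior` (registered helper of the line) — **`E` is path connected** when
  `ℝ⁴ ∖ D_k` is: the removed set `Δ₁ ∩ (ℝ⁴ ∖ D_k) = f₁(𝔹²)` is a `C^∞` image of the `2`-dimensional open
  disc in the connected open `4`-manifold `ℝ⁴ ∖ D_k`, and a closed set of codimension `≥ 2` does not
  separate (the tree's `isPathConnected_compl_of_subset_iUnion_image`, Hurewicz–Wallman Thm. IV 4 in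
  smooth general-position form).

No definitions, no named facts, no `sorry`.
-/

-- the prescribed namespace `Summit.<P>.<Sub>.…` duplicates `SmoothPoincare4` (P = Sub)
set_option linter.dupNamespace false
set_option linter.style.longLine false

noncomputable section

open scoped Manifold ContDiff Topology
open Function Set Metric Module
open Literature.Topology.FourManifolds Literature.Topology.FourManifolds.MMSW

namespace Summit.SmoothPoincare4.SmoothPoincare4.Theorems.DcrGap.MkFriends

namespace FriendsPi1

/-! ## The tube meridian -/

/-- The parameter `(0, v/2)` of the meridian point lies in the tube domain `𝔹² × 2𝔹²`. [folklore] -/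
theorem half_mem_tubeDom (v : (Metric.sphere (0 : EuclideanSpace ℝ (Fin 2)) 1)) :
    ((0 : EuclideanSpace ℝ (Fin 2)), (1 / 2 : ℝ) • (v : EuclideanSpace ℝ (Fin 2))) ∈
      ball (0 : EuclideanSpace ℝ (Fin 2)) 1 ×ˢ ball (0 : EuclideanSpace ℝ (Fin 2)) 2 := by
  refine ⟨mem_ball_self one_pos, ?_⟩
  rw [mem_ball_zero_iff, norm_smul, norm_eq_of_mem_sphere v]
  norm_num

/-- **The tube meridian lies in the disc exterior**: `T(0, v/2) ∉ D_k` (tube clause) and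
`T(0, v/2) ∉ f₁(𝔻²)` (`f₁(x) = T(x, 0)` on the open disc and `T` is injective on its domain, while
`f₁(𝕊¹) = K₁ ⊂ ∂D_k ⊂ D_k`). [folklore] -/
theorem tube_meridian_not_mem {k : ℕ}
    {K₁ : (Metric.sphere (0 : EuclideanSpace ℝ (Fin 2)) 1) → EuclideanSpace ℝ (Fin 4)}
    {f₁ : EuclideanSpace ℝ (Fin 2) → EuclideanSpace ℝ (Fin 4)}
    {T : EuclideanSpace ℝ (Fin 2) × EuclideanSpace ℝ (Fin 2) → EuclideanSpace ℝ (Fin 4)}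
    (hK₁ : IsModelKnot k K₁) (hf₁ : IsModelSliceDisc k K₁ f₁)
    (hT : ContDiffOn ℝ ((⊤ : ℕ∞) : WithTop ℕ∞) T (ball (0 : EuclideanSpace ℝ (Fin 2)) 1 ×ˢ ball (0 : EuclideanSpace ℝ (Fin 2)) 2) ∧
      InjOn T (ball (0 : EuclideanSpace ℝ (Fin 2)) 1 ×ˢ ball (0 : EuclideanSpace ℝ (Fin 2)) 2) ∧
      (∀ q ∈ ball (0 : EuclideanSpace ℝ (Fin 2)) 1 ×ˢ ball (0 : EuclideanSpace ℝ (Fin 2)) 2, Injective (fderiv ℝ T q)) ∧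
      (∀ q ∈ ball (0 : EuclideanSpace ℝ (Fin 2)) 1 ×ˢ ball (0 : EuclideanSpace ℝ (Fin 2)) 2, T q ∉ modelHandlebody k) ∧
      (∀ x ∈ ball (0 : EuclideanSpace ℝ (Fin 2)) 1, T (x, 0) = f₁ x))
    (v : (Metric.sphere (0 : EuclideanSpace ℝ (Fin 2)) 1)) :
    T ((0 : EuclideanSpace ℝ (Fin 2)), (1 / 2 : ℝ) • (v : EuclideanSpace ℝ (Fin 2))) ∉ modelHandlebody k ∧
      T ((0 : EuclideanSpace ℝ (Fin 2)), (1 / 2 : ℝ) • (v : EuclideanSpace ℝ (Fin 2))) ∉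
        f₁ '' closedBall (0 : EuclideanSpace ℝ (Fin 2)) 1 := by
  obtain ⟨-, hinj, -, hout, hbase⟩ := hT
  have hD : T ((0 : EuclideanSpace ℝ (Fin 2)), (1 / 2 : ℝ) • (v : EuclideanSpace ℝ (Fin 2))) ∉
      modelHandlebody k := hout _ (half_mem_tubeDom v)
  refine ⟨hD, ?_⟩
  rintro ⟨x, hx, hxe⟩
  rw [mem_closedBall_zero_iff] at hx
  rcases hx.lt_or_eq with hlt | heq
  · -- interior point of the disc: `f₁ x = T (x, 0)`, contradicting injectivity of `T`
    have hxdom : (x, (0 : EuclideanSpace ℝ (Fin 2))) ∈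
        ball (0 : EuclideanSpace ℝ (Fin 2)) 1 ×ˢ ball (0 : EuclideanSpace ℝ (Fin 2)) 2 :=
      ⟨mem_ball_zero_iff.2 hlt, mem_ball_self two_pos⟩
    have h1 : T (x, 0) = T ((0 : EuclideanSpace ℝ (Fin 2)), (1 / 2 : ℝ) • (v : EuclideanSpace ℝ (Fin 2))) := by
      rw [hbase x (mem_ball_zero_iff.2 hlt), hxe]
    have h2 := hinj hxdom (half_mem_tubeDom v) h1
    have h3 : (1 / 2 : ℝ) • (v : EuclideanSpace ℝ (Fin 2)) = 0 := (Prod.ext_iff.1 h2).2.symm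
    have h4 : (v : EuclideanSpace ℝ (Fin 2)) = 0 := by
      rcases smul_eq_zero.1 h3 with h | h
      · norm_num at h
      · exact h
    exact ne_zero_of_mem_unit_sphere v h4
  · -- boundary point: `f₁ x = K₁ x ∈ ∂D_k ⊆ D_k`
    have hxs : x ∈ Metric.sphere (0 : EuclideanSpace ℝ (Fin 2)) 1 := mem_sphere_zero_iff_norm.2 heq
    have h1 : f₁ x = K₁ ⟨x, hxs⟩ := hf₁.apply_sphere ⟨x, hxs⟩
    exact hD (hxe ▸ h1 ▸ modelBoundary_subset_modelHandlebody (hK₁.mem ⟨x, hxs⟩))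

/-- **The tube meridian is a continuous loop** (the tube is `C^∞` on its open domain). [folklore] -/
theorem continuous_tube_meridian {k : ℕ}
    {f₁ : EuclideanSpace ℝ (Fin 2) → EuclideanSpace ℝ (Fin 4)}
    {T : EuclideanSpace ℝ (Fin 2) × EuclideanSpace ℝ (Fin 2) → EuclideanSpace ℝ (Fin 4)}
    (hT : ContDiffOn ℝ ((⊤ : ℕ∞) : WithTop ℕ∞) T (ball (0 : EuclideanSpace ℝ (Fin 2)) 1 ×ˢ ball (0 : EuclideanSpace ℝ (Fin 2)) 2) ∧
      InjOn T (ball (0 : EuclideanSpace ℝ (Fin 2)) 1 ×ˢ ball (0 : EuclideanSpace ℝ (Fin 2)) 2) ∧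
      (∀ q ∈ ball (0 : EuclideanSpace ℝ (Fin 2)) 1 ×ˢ ball (0 : EuclideanSpace ℝ (Fin 2)) 2, Injective (fderiv ℝ T q)) ∧
      (∀ q ∈ ball (0 : EuclideanSpace ℝ (Fin 2)) 1 ×ˢ ball (0 : EuclideanSpace ℝ (Fin 2)) 2, T q ∉ modelHandlebody k) ∧
      (∀ x ∈ ball (0 : EuclideanSpace ℝ (Fin 2)) 1, T (x, 0) = f₁ x)) :
    Continuous fun v : (Metric.sphere (0 : EuclideanSpace ℝ (Fin 2)) 1) =>
      T ((0 : EuclideanSpace ℝ (Fin 2)), (1 / 2 : ℝ) • (v : EuclideanSpace ℝ (Fin 2))) := by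
  have hc : Continuous fun v : (Metric.sphere (0 : EuclideanSpace ℝ (Fin 2)) 1) =>
      ((0 : EuclideanSpace ℝ (Fin 2)), (1 / 2 : ℝ) • (v : EuclideanSpace ℝ (Fin 2))) :=
    continuous_const.prodMk (continuous_subtype_val.const_smul (1 / 2 : ℝ))
  exact hT.1.continuousOn.comp_continuous hc half_mem_tubeDom

/-! ## The disc exterior is unbounded -/

/-- **`E = ℝ⁴ ∖ (D_k ∪ Δ₁)` contains points of arbitrarily large norm** (`D_k ∪ Δ₁` is compact, hence
bounded). [folklore] -/
theorem exists_norm_gt_mem {k : ℕ}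
    {K₁ : (Metric.sphere (0 : EuclideanSpace ℝ (Fin 2)) 1) → EuclideanSpace ℝ (Fin 4)}
    {f₁ : EuclideanSpace ℝ (Fin 2) → EuclideanSpace ℝ (Fin 4)} (hf₁ : IsModelSliceDisc k K₁ f₁) (R : ℝ) :
    ∃ x : EuclideanSpace ℝ (Fin 4), R < ‖x‖ ∧ x ∉ modelHandlebody k ∧
      x ∉ f₁ '' closedBall (0 : EuclideanSpace ℝ (Fin 2)) 1 := by
  obtain ⟨R₁, hR₁⟩ := (isCompact_modelHandlebody_union_disc hf₁).isBounded.subset_closedBall 0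
  set ρ : ℝ := |R| + |R₁| + 1 with hρ
  have hρ0 : 0 ≤ ρ := by positivity
  have hρR : R < ρ := by have := le_abs_self R; have := abs_nonneg R₁; linarith
  have hρR₁ : R₁ < ρ := by have := le_abs_self R₁; have := abs_nonneg R; linarith
  set x : EuclideanSpace ℝ (Fin 4) := ρ • EuclideanSpace.single (0 : Fin 4) (1 : ℝ) with hx
  have hnorm : ‖x‖ = ρ := by
    rw [hx, norm_smul, Real.norm_eq_abs, abs_of_nonneg hρ0]
    simp
  have hxout : x ∉ modelHandlebody k ∪ f₁ '' closedBall (0 : EuclideanSpace ℝ (Fin 2)) 1 := fun h => by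
    have := mem_closedBall_zero_iff.1 (hR₁ h)
    linarith
  exact ⟨x, hnorm ▸ hρR, fun h => hxout (Or.inl h), fun h => hxout (Or.inr h)⟩

/-! ## Leaving `D_k` along the `x₃`-axis inside an open neighbourhood -/

/-- Coordinates of the ray `d + t e₃`. [folklore] -/
theorem ray_apply (d : EuclideanSpace ℝ (Fin 4)) (t : ℝ) (i : Fin 4) :
    (d + t • EuclideanSpace.single (3 : Fin 4) (1 : ℝ)) i = d i + if i = 3 then t else 0 := by
  simp

/-- The guard terms `|z - c_j|²` do not see `x₃`. [folklore] -/
theorem holeTerm_ray (k : ℕ) (j : Fin k) (d : EuclideanSpace ℝ (Fin 4)) (t : ℝ) :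
    holeTerm k j (d + t • EuclideanSpace.single (3 : Fin 4) (1 : ℝ)) = holeTerm k j d := by
  simp only [holeTerm, ray_apply]
  simp

/-- **The level function along the ray `d + t e₃` is the parabola `G_k(d) - d₃² + (d₃ + t)²`.**
[folklore] -/
theorem levelFun_ray (k : ℕ) (d : EuclideanSpace ℝ (Fin 4)) (t : ℝ) :
    levelFun k (d + t • EuclideanSpace.single (3 : Fin 4) (1 : ℝ)) =
      levelFun k d - (d 3) ^ 2 + (d 3 + t) ^ 2 := by
  simp only [levelFun, holeTerm_ray, ray_apply]
  simp

/-- **Exit from `D_k` inside an open neighbourhood.**  For `U ⊇ D_k` open and `d ∈ D_k`, the point `d`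
is joined inside `U` to a point of `U ∖ D_k`: along the ray `d + t e₃` the guard is constant and
`G_k` is the parabola `G_k(d) - d₃² + (d₃ + t)²`, which is `≤ 1` exactly for
`0 ≤ t ≤ t⋆ = √(d₃² + 1 - G_k(d)) - d₃` and `> 1` beyond; the segment up to `t⋆` lies in `D_k ⊆ U`
and a little more of the ray lies in the open `U`. [folklore] -/
theorem exists_exit (k : ℕ) {U : Set (EuclideanSpace ℝ (Fin 4))} (hU : IsOpen U)
    (hDU : modelHandlebody k ⊆ U) {d : EuclideanSpace ℝ (Fin 4)} (hd : d ∈ modelHandlebody k) :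
    ∃ d' ∈ U, d' ∉ modelHandlebody k ∧ JoinedIn U d d' := by
  set e₃ : EuclideanSpace ℝ (Fin 4) := EuclideanSpace.single (3 : Fin 4) (1 : ℝ) with he₃
  set p : ℝ → EuclideanSpace ℝ (Fin 4) := fun t => d + t • e₃ with hp
  have hpc : Continuous p := continuous_const.add (continuous_id.smul continuous_const)
  obtain ⟨hguard, hG⟩ := hd
  set G₀ := levelFun k d with hG₀
  set s : ℝ := Real.sqrt ((d 3) ^ 2 + 1 - G₀) with hs
  have hs0 : 0 ≤ s := Real.sqrt_nonneg _
  have hs2 : s ^ 2 = (d 3) ^ 2 + 1 - G₀ := by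
    rw [hs, Real.sq_sqrt]; nlinarith [sq_nonneg (d 3)]
  have hsabs : |d 3| ≤ s := by
    rw [hs, ← Real.sqrt_sq_eq_abs]
    exact Real.sqrt_le_sqrt (by linarith)
  set tstar : ℝ := s - d 3 with htstar
  have htstar0 : 0 ≤ tstar := by have := le_abs_self (d 3); linarith
  -- membership in `D_k` along the ray
  have hmemD : ∀ t, 0 ≤ t → t ≤ tstar → p t ∈ modelHandlebody k := fun t ht0 ht => by
    refine ⟨fun j => by rw [hp]; dsimp only; rw [holeTerm_ray]; exact hguard j, ?_⟩
    show levelFun k (d + t • e₃) ≤ 1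
    rw [he₃, levelFun_ray]
    have h1 : (d 3 + t) ^ 2 ≤ s ^ 2 := by
      have hlo : -s ≤ d 3 + t := by have := neg_abs_le (d 3); linarith
      have hhi : d 3 + t ≤ s := by linarith
      nlinarith [abs_le.2 ⟨hlo, hhi⟩, sq_abs (d 3 + t), abs_nonneg (d 3 + t)]
    rw [hs2] at h1
    linarith
  have hnotD : ∀ t, tstar < t → p t ∉ modelHandlebody k := fun t ht hmem => by
    have h2 : levelFun k (d + t • e₃) ≤ 1 := hmem.2
    rw [he₃, levelFun_ray] at h2
    have hgt : s < d 3 + t := by linarith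
    have h1 : s ^ 2 < (d 3 + t) ^ 2 := by nlinarith
    rw [hs2] at h1
    linarith
  -- a little room in `U` beyond the exit point
  have hstarU : p tstar ∈ U := hDU (hmemD tstar htstar0 le_rfl)
  obtain ⟨δ, hδ, hball⟩ : ∃ δ > 0, ball tstar δ ⊆ p ⁻¹' U :=
    Metric.isOpen_iff.1 (hU.preimage hpc) tstar hstarU
  set t₁ : ℝ := tstar + δ / 2 with ht₁
  have ht₁U : ∀ t, 0 ≤ t → t ≤ t₁ → p t ∈ U := fun t ht0 ht => by
    by_cases h : t ≤ tstar
    · exact hDU (hmemD t ht0 h)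
    · push Not at h
      refine hball (mem_ball.2 ?_)
      rw [Real.dist_eq, abs_of_pos (by linarith)]
      linarith
  refine ⟨p t₁, ht₁U t₁ (by linarith) le_rfl, hnotD t₁ (by linarith), ?_⟩
  -- the segment `[d, p t₁]` is the initial piece of the ray
  refine JoinedIn.of_segment_subset fun z hz => ?_
  rw [segment_eq_image'] at hz
  obtain ⟨θ, ⟨hθ0, hθ1⟩, rfl⟩ := hz
  have hpt : d + θ • (p t₁ - d) = p (θ * t₁) := by
    simp only [hp, add_sub_cancel_left, smul_smul]
  dsimp only
  rw [hpt]
  have ht₁0 : 0 ≤ t₁ := by linarith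
  exact ht₁U (θ * t₁) (mul_nonneg hθ0 ht₁0) (by nlinarith)

end FriendsPi1

/-! ## The disc exterior is path connected -/

/-- **The disc exterior `E = ℝ⁴ ∖ (D_k ∪ Δ₁)` is path connected when `ℝ⁴ ∖ D_k` is.**  In the connected
open submanifold `O = ℝ⁴ ∖ D_k` of `ℝ⁴` the closed set `Δ₁ ∩ O` is the `C^∞` image `f₁(𝔹²)` of the open
`2`-disc (the boundary circle `f₁(𝕊¹) = K₁` lies in `∂D_k ⊆ D_k`), of codimension `2`, so its
complement `E` is path connected (registered helper `helper_friendsPi1_asm_exterior` of line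
`mk_friends`). [cite: HurewiczWallman1941, Ch. IV §5, Thm. IV 4 and Cor. 1] -/
theorem helper_friendsPi1_asm_exterior : ∀ (k : ℕ) (K₁ : (Metric.sphere (0 : EuclideanSpace ℝ (Fin 2)) 1) → EuclideanSpace ℝ (Fin 4)) (f₁ : EuclideanSpace ℝ (Fin 2) → EuclideanSpace ℝ (Fin 4)), Literature.Topology.FourManifolds.MMSW.IsModelKnot k K₁ → Literature.Topology.FourManifolds.MMSW.IsModelSliceDisc k K₁ f₁ → IsPathConnected {x : EuclideanSpace ℝ (Fin 4) | x ∉ Literature.Topology.FourManifolds.MMSW.modelHandlebody k} → IsPathConnected {x : EuclideanSpace ℝ (Fin 4) | x ∉ Literature.Topology.FourManifolds.MMSW.modelHandlebody k ∧ x ∉ f₁ '' Metric.closedBall (0 : EuclideanSpace ℝ (Fin 2)) 1} := by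
  intro k K₁ f₁ hK₁ hf₁ hpc
  classical
  -- the open submanifold `O = ℝ⁴ ∖ D_k`
  let O : TopologicalSpace.Opens (EuclideanSpace ℝ (Fin 4)) :=
    ⟨{x | x ∉ modelHandlebody k}, (isClosed_modelHandlebody k).isOpen_compl⟩
  have hOcoe : (O : Set (EuclideanSpace ℝ (Fin 4))) = {x | x ∉ modelHandlebody k} := rfl
  haveI : ConnectedSpace O := by
    have h : IsConnected (O : Set (EuclideanSpace ℝ (Fin 4))) := hOcoe ▸ hpc.isConnected
    exact isConnected_iff_connectedSpace.1 h
  -- the removed set, read in `O`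
  set S : Set O := {x | (x : EuclideanSpace ℝ (Fin 4)) ∈ f₁ '' closedBall (0 : EuclideanSpace ℝ (Fin 2)) 1}
    with hS
  have hf₁c : Continuous f₁ := hf₁.1.continuous
  have hSclosed : IsClosed S :=
    (((isCompact_closedBall (0 : EuclideanSpace ℝ (Fin 2)) 1).image hf₁c).isClosed).preimage
      continuous_subtype_val
  -- the parametrisation of `S` by the open disc
  have h0 : f₁ 0 ∉ modelHandlebody k := hf₁.apply_notMem (by simp)
  let g : EuclideanSpace ℝ (Fin 2) → O := fun x =>
    if h : f₁ x ∉ modelHandlebody k then ⟨f₁ x, h⟩ else ⟨f₁ 0, h0⟩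
  have hg_eq : ∀ x ∈ ball (0 : EuclideanSpace ℝ (Fin 2)) 1, ((g x : O) : EuclideanSpace ℝ (Fin 4)) = f₁ x :=
    fun x hx => by
      have hx' : f₁ x ∉ modelHandlebody k := hf₁.apply_notMem (mem_ball_zero_iff.1 hx)
      simp only [g, dif_pos hx']
  have hg : ContMDiffOn 𝓘(ℝ, EuclideanSpace ℝ (Fin 2)) (𝓡 4) 1 g (ball (0 : EuclideanSpace ℝ (Fin 2)) 1) := by
    have h' : ContMDiffOn 𝓘(ℝ, EuclideanSpace ℝ (Fin 2)) (𝓡 4) ∞ g (ball (0 : EuclideanSpace ℝ (Fin 2)) 1) := by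
      intro x hx
      rw [← ContMDiffWithinAt.subtypeVal_comp_iff]
      have h1 : ContMDiffWithinAt 𝓘(ℝ, EuclideanSpace ℝ (Fin 2)) (𝓡 4) ∞ f₁
          (ball (0 : EuclideanSpace ℝ (Fin 2)) 1) x := (hf₁.1 x).contMDiffWithinAt
      exact h1.congr (fun y hy => hg_eq y hy) (hg_eq x hx)
    exact h'.of_le (by exact_mod_cast le_top)
  have hSsub : S ⊆ ⋃ _ : Unit, g '' ball (0 : EuclideanSpace ℝ (Fin 2)) 1 := by
    rintro x ⟨y, hy, hyx⟩
    rw [mem_closedBall_zero_iff] at hy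
    rcases hy.lt_or_eq with hlt | heq
    · refine mem_iUnion.2 ⟨(), y, mem_ball_zero_iff.2 hlt, Subtype.ext ?_⟩
      rw [hg_eq y (mem_ball_zero_iff.2 hlt), hyx]
    · exfalso
      have hys : y ∈ Metric.sphere (0 : EuclideanSpace ℝ (Fin 2)) 1 := mem_sphere_zero_iff_norm.2 heq
      have h1 : f₁ y = K₁ ⟨y, hys⟩ := hf₁.apply_sphere ⟨y, hys⟩
      exact x.2 (hyx ▸ h1 ▸ modelBoundary_subset_modelHandlebody (hK₁.mem ⟨y, hys⟩))
  have hdim : finrank ℝ (EuclideanSpace ℝ (Fin 2)) + 2 ≤ finrank ℝ (EuclideanSpace ℝ (Fin 4)) := by simp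
  have hint : ∀ x ∈ S, (𝓡 4).IsInteriorPoint x := fun x _ => BoundarylessManifold.isInteriorPoint
  have key : IsPathConnected Sᶜ :=
    isPathConnected_compl_of_subset_iUnion_image (I := 𝓡 4) (M := O) hdim hSclosed hint
      (fun _ : Unit => g) (fun _ => ball (0 : EuclideanSpace ℝ (Fin 2)) 1) (fun _ => isOpen_ball)
      (fun _ => hg) hSsub
  -- back to `ℝ⁴`
  have himg : (Subtype.val : O → EuclideanSpace ℝ (Fin 4)) '' Sᶜ =
      {x | x ∉ modelHandlebody k ∧ x ∉ f₁ '' closedBall (0 : EuclideanSpace ℝ (Fin 2)) 1} := by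
    ext x
    constructor
    · rintro ⟨y, hy, rfl⟩
      exact ⟨y.2, hy⟩
    · rintro ⟨h1, h2⟩
      exact ⟨⟨x, h1⟩, h2, rfl⟩
  rw [← himg]
  exact key.image continuous_subtype_val

end Summit.SmoothPoincare4.SmoothPoincare4.Theorems.DcrGap.MkFriends

end
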